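import Literature.NumberTheory.EllipticCurves.CongruentPhiQuarterTranslation
import Literature.NumberTheory.EllipticCurves.ModularSymbolsHeckeProofs
import Literature.NumberTheory.QuadraticFields.JacobiCharacterPrimitiveProofs
import Literature.NumberTheory.Automorphic.GL2NewvectorExistence
import Mathlib.NumberTheory.LegendreSymbol.JacobiSymbol
import HarnessLib

/-!
# Birch's formula for `L(E_{2D}, 1)`: the character `(2D/·)` modulo `8D`

[[cite: Birch1971]] via the tree's `twisted_LValue_eq_holds` (Mazur–Tate–Teitelbaum (8.6)), and
[[cite: Tunnell1983Congruent, p. 325]] (`L(E^D, s)` is the Mellin transform of `φ ⊗ χ_D`;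
`lFunction_congruentNumberCurve_eq_jacobiSym_mul_qCoeffs`) — for `D ≡ 1 (mod 4)` odd and
square-free we build the real primitive character **`chi2D D = χ₈ · (·/D)`** modulo `8D`
(`= (2D/·)` on odd arguments by reciprocity: `chi2D_natCast_of_odd`; primitive:
`isPrimitive_chi2D` [[cite: MontgomeryVaughan2007, Theorem 9.13]]; quadratic, `χ⁻¹ = χ`),
identify `L(E_{2D}, s) = L(φ ⊗ χ_{2D}, s)` (`entireLFunction_eq_twistedLSeries`, `φ` as the
cusp form `congruentPhiCuspForm` on `Γ₀(128)`), and PROVE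
**`gaussSum_mul_entireLFunction_one`**:
`τ(χ_{2D}) · L(E_{2D}, 1) = ∑_{a mod 8D} χ_{2D}(a) {∞, a/(8D)}_φ`, with `τ(χ_{2D}) ≠ 0`
(`gaussSum_chi2D_ne_zero`).  This is the `L`-value input of the diagonal Shintani coefficient
in the level-`256` route to `tunnell_converse_even` (only `τ ≠ 0`, not its sign, is needed there).

No named facts; the definitions are `chi8C` and `chi2D`.
-/

noncomputable section

open Complex
open scoped NumberTheorySymbols
open Literature.NumberTheory.QuadraticFields
open Literature.NumberTheory.EllipticCurves.Tunnell1983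

namespace Literature.NumberTheory.EllipticCurves.Shintani

/-! ### The character `χ₈ · (·/D)` modulo `8D` -/

/-- `χ₈ = (2/·)` as a Dirichlet character with values in `ℂ`. [folklore] -/
def chi8C : DirichletCharacter ℂ 8 := (ZMod.χ₈).ringHomComp (Int.castRingHom ℂ)

/-- `χ₈(n)` on naturals. [folklore] -/
theorem chi8C_natCast (n : ℕ) : chi8C n = ((ZMod.χ₈ (n : ZMod 8) : ℤ) : ℂ) := by
  simp [chi8C, MulChar.ringHomComp_apply]

variable (D : ℕ) [NeZero D]

/-- **The real character `χ_{2D} = (2D/·)`** modulo `8D`: `χ₈ · (·/D)` (for `D ≡ 1 (mod 4)` odd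
square-free this is `n ↦ (2D/n)` by reciprocity). [folklore] -/
def chi2D : DirichletCharacter ℂ (8 * D) :=
  DirichletCharacter.changeLevel (dvd_mul_right 8 D) chi8C *
    DirichletCharacter.changeLevel (dvd_mul_left D 8) (jacobiChar D)

/-- **`χ_{2D}(n) = (2D/n)`** for odd `n` and `D ≡ 1 (mod 4)`. [folklore] -/
theorem chi2D_natCast_of_odd (hD4 : D % 4 = 1) {n : ℕ} (hn : Odd n) :
    chi2D D n = (J(2 * D | n) : ℂ) := by
  have hD0 : D ≠ 0 := NeZero.ne D
  by_cases hcop : Nat.Coprime n (8 * D)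
  · -- `n` is a unit modulo `8D`: evaluate both lifted characters
    set u : (ZMod (8 * D))ˣ := ZMod.unitOfCoprime n hcop with hu
    have hun : ((u : ZMod (8 * D))) = (n : ZMod (8 * D)) := ZMod.coe_unitOfCoprime n hcop
    rw [chi2D, MulChar.mul_apply, ← hun,
      DirichletCharacter.changeLevel_eq_cast_of_dvd _ (dvd_mul_right 8 D),
      DirichletCharacter.changeLevel_eq_cast_of_dvd _ (dvd_mul_left D 8), hun,
      ZMod.cast_natCast (dvd_mul_right 8 D), ZMod.cast_natCast (dvd_mul_left D 8), chi8C_natCast,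
      jacobiChar_natCast]
    -- `(2D/n) = (2/n)(D/n) = χ₈(n) (n/D)`
    rw [jacobiSym.mul_left, jacobiSym.at_two hn, jacobiSym.quadratic_reciprocity_one_mod_four hD4 hn]
    push_cast
    ring
  · -- `n` not coprime to `8D`: `n` is odd, so `gcd(n, D) ≠ 1`, and both sides vanish
    have hnotunit : ¬ IsUnit ((n : ZMod (8 * D))) := by
      intro h
      exact hcop ((ZMod.isUnit_iff_coprime n (8 * D)).mp h)
    rw [MulChar.map_nonunit _ hnotunit]
    have hg : Int.gcd (2 * (D : ℤ)) n ≠ 1 := by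
      intro h1
      apply hcop
      -- `gcd(n, 8D) = 1` from `gcd(2D, n) = 1` and `n` odd
      have h2 : Nat.Coprime (2 * D) n := by
        have : Int.gcd (2 * (D : ℤ)) n = Nat.gcd (2 * D) n := by
          rw [show (2 * (D : ℤ)) = ((2 * D : ℕ) : ℤ) by push_cast; ring]; exact Int.gcd_natCast_natCast _ _
        rw [this] at h1; exact h1
      have hn8 : Nat.Coprime n 8 := by
        have h2n : Nat.Coprime 2 n := Nat.coprime_two_left.mpr hn
        simpa using (Nat.Coprime.pow_left 3 h2n).symm
      have hnD : Nat.Coprime n D := (Nat.Coprime.coprime_mul_left h2).symm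
      exact Nat.Coprime.mul_right hn8 hnD
    rw [jacobiSym.eq_zero_iff.mpr ⟨hn.pos.ne', hg⟩]
    simp

/-- `χ_{2D}(n) = χ₈(n) · (n/D)` for `n` coprime to `8D`. [folklore] -/
theorem chi2D_natCast_of_coprime {n : ℕ} (hcop : Nat.Coprime n (8 * D)) :
    chi2D D n = ((ZMod.χ₈ (n : ZMod 8) : ℤ) : ℂ) * (J(n | D) : ℂ) := by
  set u : (ZMod (8 * D))ˣ := ZMod.unitOfCoprime n hcop with hu
  have hun : ((u : ZMod (8 * D))) = (n : ZMod (8 * D)) := ZMod.coe_unitOfCoprime n hcop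
  rw [chi2D, MulChar.mul_apply, ← hun,
    DirichletCharacter.changeLevel_eq_cast_of_dvd _ (dvd_mul_right 8 D),
    DirichletCharacter.changeLevel_eq_cast_of_dvd _ (dvd_mul_left D 8), hun,
    ZMod.cast_natCast (dvd_mul_right 8 D), ZMod.cast_natCast (dvd_mul_left D 8), chi8C_natCast,
    jacobiChar_natCast]

open DirichletCharacter in
/-- **`χ_{2D}` is primitive modulo `8D`** for `D` odd and square-free (the Kronecker symbol of the
fundamental discriminant `8D`): if the conductor `c` were a proper divisor of `8D`, either `c ∣ 4D`
— then `n ≡ 5 (8)`, `n ≡ 1 (D)` is `≡ 1 (mod c)` with `χ(n) = χ₈(5) = -1` — or some odd prime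
`ℓ ∣ D` has `c ∣ 8D/ℓ` — then `n ≡ a (ℓ)` (a non-residue), `n ≡ 1 (8D/ℓ)` has `χ(n) = -1`.
[cite: MontgomeryVaughan2007, Theorem 9.13] -/
theorem isPrimitive_chi2D (hodd : Odd D) (hsq : Squarefree D) : (chi2D D).IsPrimitive := by
  rw [isPrimitive_def]
  set c := (chi2D D).conductor with hc
  have hcdvd : c ∣ 8 * D := conductor_dvd_level _
  have hft : (chi2D D).FactorsThrough c := factorsThrough_conductor _
  by_contra hne
  obtain ⟨k, hk⟩ := hcdvd
  have hk1 : k ≠ 1 := fun h ↦ hne (by rw [hk, h, mul_one])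
  obtain ⟨ℓ, hℓ, hℓk⟩ := Nat.exists_prime_and_dvd hk1
  have hD0 : D ≠ 0 := NeZero.ne D
  have hcq : c ∣ 8 * D := ⟨k, hk⟩
  have hker := (factorsThrough_iff_ker_unitsMap hcq).mp hft
  -- common final step: a unit `n` mod `8D`, `≡ 1 (mod c)`, with `χ(n) = -1` is absurd
  have absurd_of : ∀ n : ℕ, ∀ hn : n.Coprime (8 * D), n ≡ 1 [MOD c] → chi2D D n = -1 → False := by
    intro n hn hmod hval
    have hx : ZMod.unitOfCoprime n hn ∈ (ZMod.unitsMap hcq).ker := by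
      rw [MonoidHom.mem_ker, ZMod.unitsMap_def, Units.ext_iff, Units.coe_map, MonoidHom.coe_coe,
        ZMod.castHom_apply, Units.val_one, ZMod.coe_unitOfCoprime, ZMod.cast_natCast hcq]
      have h := (ZMod.natCast_eq_natCast_iff n 1 c).mpr hmod
      rwa [Nat.cast_one] at h
    have h1 := hker hx
    rw [MonoidHom.mem_ker, Units.ext_iff, MulChar.coe_toUnitHom, Units.val_one,
      ZMod.coe_unitOfCoprime, hval] at h1
    norm_num at h1
  by_cases hℓ2 : ℓ = 2
  · -- `2 ∣ k`, so `c ∣ 4D`: use `n ≡ 5 (mod 8)`, `n ≡ 1 (mod D)`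
    subst hℓ2
    obtain ⟨k', rfl⟩ := hℓk
    have hc4 : c ∣ 4 * D := ⟨k', by linarith⟩
    have hcop8D : Nat.Coprime 8 D := by
      have h2D : Nat.Coprime 2 D := Nat.coprime_two_left.mpr hodd
      simpa using Nat.Coprime.pow_left 3 h2D
    obtain ⟨n, hn1, hn2⟩ := Nat.chineseRemainder hcop8D 5 1
    have hn8 : n % 8 = 5 := by rw [show n % 8 = 5 % 8 from hn1]
    have hncop : n.Coprime (8 * D) := by
      refine Nat.Coprime.mul_right ?_ ((Nat.ModEq.gcd_eq hn2).trans (Nat.gcd_one_left D))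
      have : Odd n := Nat.odd_iff.mpr (by omega)
      have h2n : Nat.Coprime 2 n := Nat.coprime_two_left.mpr this
      simpa using (Nat.Coprime.pow_left 3 h2n).symm
    refine absurd_of n hncop ?_ ?_
    · -- `n ≡ 1 (mod 4D)` hence mod `c`
      have h4 : n ≡ 1 [MOD 4] := by
        show n % 4 = 1 % 4
        omega
      have h4D : n ≡ 1 [MOD 4 * D] := by
        have hcop4D : Nat.Coprime 4 D := by
          have h2D : Nat.Coprime 2 D := Nat.coprime_two_left.mpr hodd
          simpa using Nat.Coprime.pow_left 2 h2D
        exact (Nat.modEq_and_modEq_iff_modEq_mul hcop4D).mp ⟨h4, hn2⟩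
      exact Nat.ModEq.of_dvd hc4 h4D
    · rw [chi2D_natCast_of_coprime D hncop, ZMod.χ₈_nat_eq_if_mod_eight, hn8]
      have hJ : J((n : ℤ) | D) = 1 := by
        rw [← jacobiSym_natCast_mod, show n % D = 1 % D from hn2, jacobiSym_natCast_mod, Nat.cast_one,
          jacobiSym.one_left]
      rw [hJ]
      norm_num
      omega
  · -- odd prime `ℓ ∣ D` with `ℓ ∤ c`: non-residue mod `ℓ`
    have hℓ8D : ℓ ∣ 8 * D := hk ▸ (hℓk.mul_left c)
    have hℓD : ℓ ∣ D := by
      have h8 : ¬ ℓ ∣ 8 := by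
        intro h
        have := (Nat.prime_dvd_prime_iff_eq hℓ Nat.prime_two).mp (hℓ.dvd_of_dvd_pow (show ℓ ∣ 2 ^ 3 from h))
        exact hℓ2 this
      exact ((Nat.Prime.coprime_iff_not_dvd hℓ).mpr h8).dvd_of_dvd_mul_left hℓ8D
    have hℓc : ¬ ℓ ∣ c := by
      intro h
      have h2 : ℓ * ℓ ∣ 8 * D := hk ▸ mul_dvd_mul h hℓk
      have hℓodd : ¬ ℓ ∣ 8 := by
        intro h8
        have := (Nat.prime_dvd_prime_iff_eq hℓ Nat.prime_two).mp (hℓ.dvd_of_dvd_pow (show ℓ ∣ 2 ^ 3 from h8))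
        exact hℓ2 this
      have hcopℓ8 : Nat.Coprime (ℓ * ℓ) 8 :=
        Nat.Coprime.mul_left ((Nat.Prime.coprime_iff_not_dvd hℓ).mpr hℓodd) ((Nat.Prime.coprime_iff_not_dvd hℓ).mpr hℓodd)
      have h3 : ℓ * ℓ ∣ D := hcopℓ8.dvd_of_dvd_mul_left h2
      exact hℓ.one_lt.ne' (Nat.isUnit_iff.mp (hsq ℓ h3))
    -- cofactor `m = 8D/ℓ`, coprime to `ℓ`, divisible by `c`
    set m := 8 * D / ℓ with hm
    have hqm : 8 * D = ℓ * m := (Nat.mul_div_cancel' hℓ8D).symm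
    have hℓ0 : ℓ ≠ 0 := hℓ.ne_zero
    have hm0 : m ≠ 0 := fun h ↦ by
      have : 8 * D = 0 := by rw [hqm, h, mul_zero]
      omega
    have hcopℓm : ℓ.Coprime m := by
      rw [Nat.Prime.coprime_iff_not_dvd hℓ]
      intro h
      have h2 : ℓ * ℓ ∣ 8 * D := hqm ▸ mul_dvd_mul_left ℓ h
      have hℓodd : ¬ ℓ ∣ 8 := by
        intro h8
        have := (Nat.prime_dvd_prime_iff_eq hℓ Nat.prime_two).mp (hℓ.dvd_of_dvd_pow (show ℓ ∣ 2 ^ 3 from h8))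
        exact hℓ2 this
      have hcopℓ8 : Nat.Coprime (ℓ * ℓ) 8 :=
        Nat.Coprime.mul_left ((Nat.Prime.coprime_iff_not_dvd hℓ).mpr hℓodd) ((Nat.Prime.coprime_iff_not_dvd hℓ).mpr hℓodd)
      have h3 : ℓ * ℓ ∣ D := hcopℓ8.dvd_of_dvd_mul_left h2
      exact hℓ.one_lt.ne' (Nat.isUnit_iff.mp (hsq ℓ h3))
    have hcm : c ∣ m :=
      (((Nat.Prime.coprime_iff_not_dvd hℓ).mpr hℓc).symm).dvd_of_dvd_mul_left (hqm ▸ ⟨k, hk⟩)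
    haveI := Fact.mk hℓ
    have hchar : ringChar (ZMod ℓ) ≠ 2 := by rwa [ZMod.ringChar_zmod_n]
    obtain ⟨a, ha⟩ := quadraticChar_exists_neg_one hchar
    have ha0 : a ≠ 0 := by
      rintro rfl
      rw [MulChar.map_zero] at ha
      norm_num at ha
    obtain ⟨n, hn1, hn2⟩ := Nat.chineseRemainder hcopℓm a.val 1
    have hnℓ : n % ℓ = a.val := by
      rw [show n % ℓ = a.val % ℓ from hn1, Nat.mod_eq_of_lt (ZMod.val_lt a)]
    have hJℓ : J((n : ℤ) | ℓ) = -1 := by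
      rw [← jacobiSym_natCast_mod, hnℓ, ← jacobiSym.legendreSym.to_jacobiSym, legendreSym,
        Int.cast_natCast, ZMod.natCast_zmod_val]
      exact ha
    -- `n ≡ 1 (mod m)` with `8 ∣ m` and `(D/ℓ) ∣ m`
    have h8m : 8 ∣ m := by
      have h8ℓ : Nat.Coprime 8 ℓ := by
        have hℓodd : ¬ ℓ ∣ 8 := by
          intro h8
          have := (Nat.prime_dvd_prime_iff_eq hℓ Nat.prime_two).mp (hℓ.dvd_of_dvd_pow (show ℓ ∣ 2 ^ 3 from h8))
          exact hℓ2 this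
        exact ((Nat.Prime.coprime_iff_not_dvd hℓ).mpr hℓodd).symm
      exact h8ℓ.dvd_of_dvd_mul_left (hqm ▸ dvd_mul_right 8 D)
    obtain ⟨D', hD'⟩ := hℓD
    have hmD' : m = 8 * D' := by
      apply Nat.eq_of_mul_eq_mul_left hℓ.pos
      rw [← hqm, hD']; ring
    have hn8 : n % 8 = 1 := by
      have := Nat.ModEq.of_dvd h8m hn2
      exact this
    have hnD' : n ≡ 1 [MOD D'] := Nat.ModEq.of_dvd (by rw [hmD']; exact dvd_mul_left D' 8) hn2
    have hD'0 : D' ≠ 0 := by rintro rfl; exact hD0 (by rw [hD', mul_zero])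
    have hJD' : J((n : ℤ) | D') = 1 := by
      rw [← jacobiSym_natCast_mod, show n % D' = 1 % D' from hnD', jacobiSym_natCast_mod, Nat.cast_one,
        jacobiSym.one_left]
    have hnℓ' : n.Coprime ℓ := by
      refine ((Nat.Prime.coprime_iff_not_dvd hℓ).mpr fun h ↦ ha0 ?_).symm
      rw [← ZMod.val_eq_zero, ← hnℓ]
      exact Nat.mod_eq_zero_of_dvd h
    have hnm : n.Coprime m := (Nat.ModEq.gcd_eq hn2).trans (Nat.gcd_one_left m)
    have hncop : n.Coprime (8 * D) := hqm ▸ Nat.Coprime.mul_right hnℓ' hnm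
    refine absurd_of n hncop (Nat.ModEq.of_dvd hcm hn2) ?_
    rw [chi2D_natCast_of_coprime D hncop, ZMod.χ₈_nat_eq_if_mod_eight, hn8, hD',
      show ((ℓ * D' : ℕ) : ℕ) = ℓ * D' from rfl, jacobiSym.mul_right' (n : ℤ) hℓ0 hD'0, hJℓ, hJD']
    norm_num
    omega

/-! ### `L(E_{2D}, s) = L(φ, χ_{2D}, s)` and Birch's formula -/

open Literature.NumberTheory.EllipticCurves.ModularForms in
/-- `a_n(φ)` vanishes for even `n`. [folklore] -/
theorem qCoeffs_congruentPhi_of_even {n : ℕ} (hn : Even n) : qCoeffs congruentPhi n = 0 := by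
  rw [qCoeffs_congruentPhi]
  simp [QuadraticFields.GaussianPrimary.primarySum_of_even (even_iff_two_dvd.mp hn)]

open Literature.NumberTheory.EllipticCurves.ModularForms in
/-- **`L(E_{2D}, s) = L(φ ⊗ χ_{2D}, s)` on `re s > 3/2`** (`D ≡ 1 (mod 4)` square-free,
`2D` square-free): coefficientwise `a_n(E_{2D}) = (2D/n) a_n(φ) = χ_{2D}(n) a_n(φ)`.
[cite: Tunnell1983Congruent, p. 325] -/
theorem entireLFunction_eq_twistedLSeries (hD4 : D % 4 = 1) (hsq2 : Squarefree (2 * D))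
    (hL : (congruentNumberCurve (2 * D)).HasEntireLFunction) {s : ℂ} (hs : (3 / 2 : ℝ) < s.re) :
    (congruentNumberCurve (2 * D)).entireLFunction s = twistedLSeries congruentPhiCuspForm (chi2D D) s := by
  rw [WeierstrassCurve.entireLFunction_eq_LSeries _ hL hs, WeierstrassCurve.LSeries, twistedLSeries]
  refine LSeries_congr (fun {n} hn ↦ ?_) s
  simp only [Function.comp_apply]
  have hcoef : cuspCoeff congruentPhiCuspForm n = qCoeffs congruentPhi n := rfl
  rw [hcoef, lFunction_congruentNumberCurve_eq_jacobiSym_mul_qCoeffs hsq2 hn]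
  rcases Nat.even_or_odd n with he | ho
  · rw [qCoeffs_congruentPhi_of_even he]; simp
  · rw [chi2D_natCast_of_odd D hD4 ho]; push_cast; ring

/-- A level-raised quadratic character is quadratic. [folklore] -/
theorem isQuadratic_changeLevel {n m : ℕ} [NeZero m] {χ : DirichletCharacter ℂ n} (h : χ.IsQuadratic)
    (hd : n ∣ m) : (DirichletCharacter.changeLevel hd χ).IsQuadratic := by
  intro a
  by_cases hu : IsUnit a
  · obtain ⟨u, rfl⟩ := hu
    rw [DirichletCharacter.changeLevel_eq_cast_of_dvd χ hd u]
    exact h _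
  · exact Or.inl (MulChar.map_nonunit _ hu)

/-- A product of quadratic characters is quadratic. [folklore] -/
theorem isQuadratic_mul {R : Type*} [CommMonoid R] {χ ψ : MulChar R ℂ} (hχ : χ.IsQuadratic)
    (hψ : ψ.IsQuadratic) : (χ * ψ).IsQuadratic := by
  intro a
  rw [MulChar.mul_apply]
  rcases hχ a with h | h | h <;> rcases hψ a with h' | h' | h' <;> simp [h, h']

/-- `χ_{2D}` is quadratic (values `0, ±1`). [folklore] -/
theorem isQuadratic_chi2D : (chi2D D).IsQuadratic :=
  isQuadratic_mul (isQuadratic_changeLevel (ZMod.isQuadratic_χ₈.comp _) _)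
    (isQuadratic_changeLevel isQuadratic_jacobiChar _)

/-- `χ_{2D}` is real: `χ⁻¹ = χ`. [folklore] -/
theorem chi2D_inv : (chi2D D)⁻¹ = chi2D D := (isQuadratic_chi2D D).inv

open Literature.NumberTheory.EllipticCurves.ModularForms in
/-- **Birch's formula for `L(E_{2D}, 1)`**: for `D ≡ 1 (mod 4)` with `2D` square-free,
`τ(χ_{2D}) · L(E_{2D}, 1) = ∑_{a mod 8D} χ_{2D}(a) {∞, a/(8D)}_φ` (`φ` the congruent-number newform
on `Γ₀(128)`, `τ` the Gauss sum, which is non-zero). [cite: Birch1971] [cite: Tunnell1983Congruent, p. 325] -/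
theorem gaussSum_mul_entireLFunction_one (hodd : Odd D) (hsq : Squarefree D) (hD4 : D % 4 = 1)
    (hsq2 : Squarefree (2 * D)) (hL : (congruentNumberCurve (2 * D)).HasEntireLFunction) :
    gaussSum (chi2D D) (ZMod.stdAddChar (N := 8 * D)) * (congruentNumberCurve (2 * D)).entireLFunction 1 =
      twistedSymbolSum congruentPhiCuspForm (chi2D D) := by
  have h := twisted_LValue_eq_holds congruentPhiCuspForm (m := 8 * D) (isPrimitive_chi2D D hodd hsq)
    (WeierstrassCurve.differentiable_entireLFunction _ hL)
    (fun s hs ↦ entireLFunction_eq_twistedLSeries D hD4 hsq2 hL (by linarith))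
  rwa [chi2D_inv] at h

/-- The Gauss sum `τ(χ_{2D})` is non-zero. [folklore] -/
theorem gaussSum_chi2D_ne_zero (hodd : Odd D) (hsq : Squarefree D) :
    gaussSum (chi2D D) (ZMod.stdAddChar (N := 8 * D)) ≠ 0 :=
  Literature.NumberTheory.Automorphic.DirichletCharacter.IsPrimitive.gaussSum_stdAddChar_ne_zero
    (isPrimitive_chi2D D hodd hsq)

end Literature.NumberTheory.EllipticCurves.Shintani
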